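import Summits.RiemannHypothesis.RiemannHypothesis.Theorems.PfPersistenceFloorNodelessOdd
import HarnessLib

/-!
# PF persistence — the PARITY-MASS LAW of (floor-)one-signed profiles, both sectors (pub-rhpf, cand-6 gen 6)

**HONEST FRAMING. This is a long-odds MECHANISM SEARCH ('mechanism/rigidity campaign'); no RH claims.** Everything
below is RH-free, weight-free trigonometry about the cell's SHAPE readers (`OneSigned` / `FloorOneSigned` on the even
profile `θ_u = Σ u_n ξ_n`, `OneSignedOdd` / `FloorOneSignedOdd` on the odd profile over the half-window `H = [0, L/2]`);
nothing here bears on the truth of RH. Labels: PROVED = kernel-checked here or in the imported tree files.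

* §1 HALF-PERIOD SHIFT (even sector, PROVED): `ξ_n(x + L/2) = (−1)^n ξ_n(x)`, hence `θ_u(x ± L/2) = θ_{flip u}(x)` with
  the PARITY FLIP `(flip u)_n = (−1)^n u_n`, every point of the window has a half-period partner IN the window, and
  `θ_u + θ_{flip u} = 2 θ_{u^{ev}}` (`u^{ev}` = the even-indexed part of `u`).
* §2 **PARITY-MASS LAW, even sector (PROVED `parityMass_le_of_floorOneSigned`):** if `θ_u` is `φ`-floor one-signed on
  `[-L/2, L/2]` (`0 < L`, `0 ≤ φ`) then `‖u‖² ≤ 8 ‖u^{ev}‖² + 2 φ² (2N+1) ‖u‖²`; raw (`φ = 0`): `‖u‖² ≤ 8 ‖u^{ev}‖²`;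
  `4 φ² (2N+1) ≤ 1`: `‖u‖² ≤ 16 ‖u^{ev}‖²`. So a one-signed profile carries at least `1/8` of its `ℓ²`-mass on the
  EVEN-indexed modes, and a nonzero vector supported on odd-indexed modes is never one-signed (its profile is
  anti-periodic under the half-period shift). Ingredients: the pointwise domination `|θ_u| ≤ 2|θ_{u^{ev}}| + φ·max|θ_u|`,
  Parseval (`CentralMassFloor.integral_profile_sq`) and `max|θ_u|² ≤ (2N+1)‖u‖²/L`.
* §3 (companion file `PfPersistenceParityMassLawOdd`) THE ODD-SECTOR MIRROR: on `H` the reflection `x ↦ L/2 − x`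
  fixes the odd-n sine modes and negates the even-n ones, whence the same law with the odd-MODE part.

USE (file `PfPersistenceHeavySlotMirrorNodal`): at the MIRROR WINDOW `a = log p` a heavy dial concentrates the
bottom vector on one parity class of modes (`evenBlock_dial_mirror`), and the laws above turn that concentration into
NODALITY of the relevant sector — an RH-free, binder-free statement that the (floored) nodeless readers reject the
heavy-dial witness family at its own mirror window.
-/

set_option linter.dupNamespace false  -- the mandated namespace repeats `RiemannHypothesis`

noncomputable section

open Real Set Matrix Finset

namespace Summit.RiemannHypothesis.RiemannHypothesis.Theorems.PfPersistence

/-! ## §1 Even sector: the parity flip and the half-period shift -/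

/-- The PARITY FLIP of an even-sector coefficient vector: `(flipVec u)_n = (−1)^n u_n`. [folklore] -/
def flipVec {N : ℕ} (u : Fin (N + 1) → ℝ) : Fin (N + 1) → ℝ := fun n => (-1 : ℝ) ^ (n : ℕ) * u n

/-- The EVEN-INDEXED PART of `u`: the modes `ξ_0, ξ_2, …` are kept, the odd-indexed ones zeroed. [folklore] -/
def evenIdxPart {N : ℕ} (u : Fin (N + 1) → ℝ) : Fin (N + 1) → ℝ := fun n => if Even (n : ℕ) then u n else 0

/-- PROVED: the flip is an involution. [folklore] -/
theorem flipVec_flipVec {N : ℕ} (u : Fin (N + 1) → ℝ) : flipVec (flipVec u) = u := by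
  funext n
  simp only [flipVec]
  rw [← mul_assoc, ← mul_pow]
  norm_num

/-- PROVED: `u + flip u = 2 u^{ev}` coordinatewise. [folklore] -/
theorem add_flipVec_apply {N : ℕ} (u : Fin (N + 1) → ℝ) (n : Fin (N + 1)) :
    u n + flipVec u n = 2 * evenIdxPart u n := by
  unfold flipVec evenIdxPart
  rcases Nat.even_or_odd (n : ℕ) with h | h
  · rw [if_pos h, h.neg_one_pow]; ring
  · rw [if_neg (Nat.not_even_iff_odd.2 h), h.neg_one_pow]; ring

/-- **PROVED — HALF-PERIOD SHIFT:** `ξ_n(x + L/2) = (−1)^n ξ_n(x)` (`L ≠ 0`). [folklore] -/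
theorem xiEven_add_half {L : ℝ} (hL : L ≠ 0) (n : ℕ) (x : ℝ) :
    xiEven L n (x + L / 2) = (-1 : ℝ) ^ n * xiEven L n x := by
  unfold xiEven
  by_cases hn : n = 0
  · subst hn; simp
  · rw [if_neg hn, if_neg hn]
    have harg : 2 * π * n * (x + L / 2) / L = 2 * π * n * x / L + n * π := by
      field_simp
    rw [harg, Real.cos_add_nat_mul_pi]
    ring

/-- PROVED: `θ_u(x + L/2) = θ_{flip u}(x)`. [folklore] -/
theorem profile_add_half {L : ℝ} (hL : L ≠ 0) {N : ℕ} (u : Fin (N + 1) → ℝ) (x : ℝ) :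
    profile L u (x + L / 2) = profile L (flipVec u) x := by
  unfold profile flipVec
  refine Finset.sum_congr rfl fun n _ => ?_
  rw [xiEven_add_half hL]
  ring

/-- PROVED: `θ_u(x − L/2) = θ_{flip u}(x)`. [folklore] -/
theorem profile_sub_half {L : ℝ} (hL : L ≠ 0) {N : ℕ} (u : Fin (N + 1) → ℝ) (x : ℝ) :
    profile L u (x - L / 2) = profile L (flipVec u) x := by
  have h := profile_add_half hL (flipVec u) (x - L / 2)
  rw [sub_add_cancel, flipVec_flipVec] at h
  exact h.symm

/-- PROVED: `θ_u + θ_{flip u} = 2 θ_{u^{ev}}`. [folklore] -/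
theorem profile_add_profile_flipVec {L : ℝ} {N : ℕ} (u : Fin (N + 1) → ℝ) (x : ℝ) :
    profile L u x + profile L (flipVec u) x = 2 * profile L (evenIdxPart u) x := by
  unfold profile
  rw [← Finset.sum_add_distrib, Finset.mul_sum]
  refine Finset.sum_congr rfl fun n _ => ?_
  rw [← add_mul, add_flipVec_apply]
  ring

/-- PROVED: every point of the window `[-L/2, L/2]` (`0 < L`) has a HALF-PERIOD PARTNER in the window at which `θ_u`
takes the value `θ_{flip u}(x)`. [folklore] -/
theorem exists_halfPeriod_partner {L : ℝ} (hL : 0 < L) {N : ℕ} (u : Fin (N + 1) → ℝ) {x : ℝ}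
    (hx : x ∈ Icc (-(L / 2)) (L / 2)) :
    ∃ x' ∈ Icc (-(L / 2)) (L / 2), profile L u x' = profile L (flipVec u) x := by
  by_cases h : x ≤ 0
  · exact ⟨x + L / 2, ⟨by linarith [hx.1], by linarith⟩, profile_add_half hL.ne' u x⟩
  · exact ⟨x - L / 2, ⟨by linarith [not_le.1 h], by linarith [hx.2]⟩, profile_sub_half hL.ne' u x⟩

/-! ## §2 The parity-mass law, even sector -/

/-- PROVED: `(max_{window} |θ_u|)² ≤ ‖u‖² (2N+1)/L` (`0 < L`). [folklore] -/
theorem profileMax_sq_le {L : ℝ} (hL : 0 < L) {N : ℕ} (u : Fin (N + 1) → ℝ) :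
    profileMax L u ^ 2 ≤ (u ⬝ᵥ u) * ((2 * N + 1) / L) := by
  set R := Real.sqrt ((u ⬝ᵥ u) * ((2 * N + 1) / L)) with hR
  have hle : profileMax L u ≤ R := by
    unfold profileMax
    apply csSup_le ((Set.nonempty_Icc.2 (by linarith)).image _)
    rintro _ ⟨x, _, rfl⟩
    exact Real.abs_le_sqrt (CentralMassFloor.profile_sq_le hL u x)
  calc profileMax L u ^ 2 ≤ R ^ 2 := pow_le_pow_left₀ (profileMax_nonneg L u) hle 2
    _ = (u ⬝ᵥ u) * ((2 * N + 1) / L) := Real.sq_sqrt (mul_nonneg (dotProduct_self_nonneg_real u) (by positivity))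

/-- PROVED (pointwise domination): a `φ`-floor one-signed profile is dominated, at every point of the window, by
twice its even-indexed part plus the floor: `|θ_u(x)| ≤ 2 |θ_{u^{ev}}(x)| + φ · max|θ_u|`. [folklore] -/
theorem abs_profile_le_of_floorOneSigned {L φ : ℝ} (hL : 0 < L) (hφ : 0 ≤ φ) {N : ℕ} {u : Fin (N + 1) → ℝ}
    (h : FloorOneSigned L φ u) {x : ℝ} (hx : x ∈ Icc (-(L / 2)) (L / 2)) :
    |profile L u x| ≤ 2 * |profile L (evenIdxPart u) x| + φ * profileMax L u := by
  obtain ⟨x', hx', hval⟩ := exists_halfPeriod_partner hL u hx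
  have hsum := profile_add_profile_flipVec (L := L) u x
  have hφM : 0 ≤ φ * profileMax L u := mul_nonneg hφ (profileMax_nonneg L u)
  have habs := le_abs_self (profile L (evenIdxPart u) x)
  have habs' := neg_abs_le (profile L (evenIdxPart u) x)
  rw [abs_le]
  rcases h with h | h
  · have h1 := h x hx
    have h2 := h x' hx'
    rw [hval] at h2
    constructor <;> linarith
  · have h1 := h x hx
    have h2 := h x' hx'
    rw [hval] at h2
    constructor <;> linarith

/-- **PROVED — THE PARITY-MASS LAW (even sector):** a `φ`-floor one-signed profile (`0 < L`, `0 ≤ φ`) has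
`‖u‖² ≤ 8 ‖u^{ev}‖² + 2 φ² (2N+1) ‖u‖²`. [folklore] -/
theorem parityMass_le_of_floorOneSigned {L φ : ℝ} (hL : 0 < L) (hφ : 0 ≤ φ) {N : ℕ} {u : Fin (N + 1) → ℝ}
    (h : FloorOneSigned L φ u) :
    u ⬝ᵥ u ≤ 8 * (evenIdxPart u ⬝ᵥ evenIdxPart u) + 2 * φ ^ 2 * (2 * N + 1) * (u ⬝ᵥ u) := by
  set M := profileMax L u with hMdef
  have hpt : ∀ x ∈ Icc (-(L / 2)) (L / 2),
      profile L u x ^ 2 ≤ 8 * profile L (evenIdxPart u) x ^ 2 + 2 * (φ * M) ^ 2 := by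
    intro x hx
    have h1 := abs_profile_le_of_floorOneSigned hL hφ h hx
    have hsq : |profile L u x| ^ 2 ≤ (2 * |profile L (evenIdxPart u) x| + φ * M) ^ 2 :=
      pow_le_pow_left₀ (abs_nonneg _) h1 2
    rw [sq_abs] at hsq
    nlinarith [sq_abs (profile L (evenIdxPart u) x), sq_nonneg (2 * |profile L (evenIdxPart u) x| - φ * M)]
  have hc1 : Continuous fun x => profile L u x ^ 2 := (CentralMassFloor.continuous_profile L u).pow 2
  have hc2 : Continuous fun x => 8 * profile L (evenIdxPart u) x ^ 2 :=
    continuous_const.mul ((CentralMassFloor.continuous_profile L _).pow 2)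
  have hc3 : Continuous fun _ : ℝ => 2 * (φ * M) ^ 2 := continuous_const
  have hint : ∫ x in (-(L / 2))..(L / 2), profile L u x ^ 2
      ≤ ∫ x in (-(L / 2))..(L / 2), (8 * profile L (evenIdxPart u) x ^ 2 + 2 * (φ * M) ^ 2) :=
    intervalIntegral.integral_mono_on (by linarith) (hc1.intervalIntegrable _ _)
      ((hc2.add hc3).intervalIntegrable _ _) hpt
  have hrhs : ∫ x in (-(L / 2))..(L / 2), (8 * profile L (evenIdxPart u) x ^ 2 + 2 * (φ * M) ^ 2)
      = 8 * (evenIdxPart u ⬝ᵥ evenIdxPart u) + 2 * (φ * M) ^ 2 * L := by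
    rw [intervalIntegral.integral_add (hc2.intervalIntegrable _ _) (hc3.intervalIntegrable _ _),
      intervalIntegral.integral_const_mul, CentralMassFloor.integral_profile_sq hL, intervalIntegral.integral_const,
      smul_eq_mul]
    ring
  have hM2 : M ^ 2 ≤ (u ⬝ᵥ u) * ((2 * N + 1) / L) := profileMax_sq_le hL u
  have hML : (φ * M) ^ 2 * L ≤ φ ^ 2 * (2 * N + 1) * (u ⬝ᵥ u) := by
    have h1 : φ ^ 2 * M ^ 2 ≤ φ ^ 2 * ((u ⬝ᵥ u) * ((2 * N + 1) / L)) := mul_le_mul_of_nonneg_left hM2 (sq_nonneg φ)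
    calc (φ * M) ^ 2 * L = φ ^ 2 * M ^ 2 * L := by ring
      _ ≤ φ ^ 2 * ((u ⬝ᵥ u) * ((2 * N + 1) / L)) * L := mul_le_mul_of_nonneg_right h1 hL.le
      _ = φ ^ 2 * (2 * N + 1) * (u ⬝ᵥ u) := by
          field_simp
  rw [CentralMassFloor.integral_profile_sq hL u, hrhs] at hint
  linarith

/-- PROVED (raw reader): a one-signed profile carries at least `1/8` of its mass on the even-indexed modes:
`‖u‖² ≤ 8 ‖u^{ev}‖²`. [folklore] -/
theorem parityMass_le_of_oneSigned {L : ℝ} (hL : 0 < L) {N : ℕ} {u : Fin (N + 1) → ℝ} (h : OneSigned L u) :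
    u ⬝ᵥ u ≤ 8 * (evenIdxPart u ⬝ᵥ evenIdxPart u) := by
  have h0 := parityMass_le_of_floorOneSigned hL le_rfl ((floorOneSigned_zero_iff L u).2 h)
  simpa using h0

/-- PROVED (floored reader, small floor): `4 φ² (2N+1) ≤ 1 ⇒ ‖u‖² ≤ 16 ‖u^{ev}‖²`. [folklore] -/
theorem parityMass_le_of_floorOneSigned' {L φ : ℝ} (hL : 0 < L) (hφ : 0 ≤ φ) {N : ℕ} {u : Fin (N + 1) → ℝ}
    (hφN : 4 * φ ^ 2 * (2 * N + 1) ≤ 1) (h : FloorOneSigned L φ u) :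
    u ⬝ᵥ u ≤ 16 * (evenIdxPart u ⬝ᵥ evenIdxPart u) := by
  have h0 := parityMass_le_of_floorOneSigned hL hφ h
  have h1 : 4 * φ ^ 2 * (2 * N + 1) * (u ⬝ᵥ u) ≤ 1 * (u ⬝ᵥ u) :=
    mul_le_mul_of_nonneg_right hφN (dotProduct_self_nonneg_real u)
  linarith

/-- PROVED: a nonzero coefficient vector supported on ODD-indexed modes is NEVER one-signed. [folklore] -/
theorem not_oneSigned_of_evenIdxPart_eq_zero {L : ℝ} (hL : 0 < L) {N : ℕ} {u : Fin (N + 1) → ℝ} (hu : u ≠ 0)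
    (he : evenIdxPart u = 0) : ¬ OneSigned L u := by
  intro h
  have h1 := parityMass_le_of_oneSigned hL h
  rw [he] at h1
  simp only [dotProduct_zero, mul_zero] at h1
  exact hu (dotProduct_self_eq_zero.1 (le_antisymm h1 (dotProduct_self_nonneg_real u)))

end Summit.RiemannHypothesis.RiemannHypothesis.Theorems.PfPersistence
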